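import Mathlib
import HarnessLib
import Summits.HubbardSuperconductivity.HubbardSuperconductivity.Theorems.KLProgrammeKLRegimeEngineScaleZeroE4SpaceMoment

/-!
# Route `KLProgramme` — crux K3, child 4 VL (stmt-HubbardSuperconductivity-20440), located risk #8 «(VL)-DEAD-LEG»: the covariance data of the
# UV-dressed propagator `C^K_{>Λ}` at EVERY cutoff — §3, the first SPACE moment at `0 < Λ ≤ 4`, telescoped over the frame pieces

Cell gate-hubbard-kl, seat hubbard-kl-k3c4-p2 g10; companion of `…UVCovarianceMomentsAt` (§1 mass, §2 time moment; see its docstring for the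
context: pen rulings (R59t)(ii)/(R59u)/(R59aa), BGM 2006 (4.8b)).  k3c2-p1's scale-`0` export `EngineV8.spaceMoment_scaleZero_of_frameOK` is keyed
to `Λ = klE0` only through `klE0_pos_le_four`; every lemma below it (`HubbardUVBandPieces.spaceMoment_basePiece_le / spaceMoment_incrPiece_le`,
`scaledIncrQ_le / scaledIncrQ'_le`, `uvSpaceMomentConst_le_linear`) takes a free `0 < Λ ≤ 4`.  This file is that export with `klE0 ↦ Λ`:

* `uvIncrQ_frame_nonneg_at`, `spaceMoment_incrPiece_frame_le_at`, `spaceMoment_basePiece_frame_le_at` — the pieces of an admissible frame;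
* **`spaceMoment_uvCov_of_frameOK`** — for `FrameOK R U N_sc μ K`, `R.WF`, `|U| ≤ 1`, `klBetaMin ≤ β`, `β³ ≤ M`, `2M ≤ N`, cutoff derivatives
  `≤ B` up to order `5`, `0 < Λ ≤ 4`, `l ≠ l'`:
  `(β/N)·Σ_{a,b⃗} |b̃_l|·‖S[G_σ](a,b⃗)‖ ≤ X₀(Λ,B) + X_lin(Λ,B)·4608·(1 + ΣGfr)⁴·((N_sc + 1)·U² + 2|U|)` — uniform in `L`, `M`, `N`, `μ`, the frame.

Everything is proved; no definitions, no named facts.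
-/

noncomputable section

namespace Summit.HubbardSuperconductivity.HubbardSuperconductivity.Theorems.UVCovarianceAt

set_option linter.dupNamespace false -- summit = problem name (single-conjunct summit), D-0017

open Real Finset Literature.MathematicalPhysics.QuantumLattice Literature.Probability.LatticeModels
open Literature.MathematicalPhysics.QuantumLattice.FermiRG
open Summit.HubbardSuperconductivity.HubbardSuperconductivity.Theorems.KLRegimeSplit
open Summit.HubbardSuperconductivity.HubbardSuperconductivity.Theorems.DispersionFlow
open Summit.HubbardSuperconductivity.HubbardSuperconductivity.Theorems.ScaleZeroDecay
open Summit.HubbardSuperconductivity.HubbardSuperconductivity.Theorems.EngineV8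

variable {L M N : ℕ}

/-! ## §3 The first SPACE moment at every cutoff `0 < Λ ≤ 4`, telescoped over the frame pieces -/

section Space

variable [NeZero L] [NeZero N] {R : RenConsts} {U μ β Λ : ℝ} {Nsc : ℕ} {Kp : ℕ → TrigPolyC4v} {B : ℝ}

/-- The increment amplitudes at cutoff `Λ > 0` are non-negative (`B ≥ 1`, `R.WF`). -/
theorem uvIncrQ_frame_nonneg_at (hRwf : R.WF) (hB1 : 1 ≤ B) (hΛ : 0 < Λ) (m k : ℕ) :
    0 ≤ uvIncrQ B Λ ((4 + 4 / 3 * (R.Gfr 1 + R.Gfr 2 + R.Gfr 3)) * (2 : ℝ) ^ m)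
        (fun i => R.Gfr i * uPow i U * (((2 : ℝ) ^ m) ^ (2 * i) / ((2 : ℝ) ^ m) ^ 4)) k ∧
      0 ≤ uvIncrQ' B Λ ((4 + 4 / 3 * (R.Gfr 1 + R.Gfr 2 + R.Gfr 3)) * (2 : ℝ) ^ m)
        (fun i => R.Gfr i * uPow i U * (((2 : ℝ) ^ m) ^ (2 * i) / ((2 : ℝ) ^ m) ^ 4)) k := by
  have hG0 : ∀ j, 0 ≤ R.Gfr j := hRwf.2.2
  have hsum : 0 ≤ ∑ j ∈ Finset.range (k + 1), (k.choose j : ℝ) * (j.factorial : ℝ) *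
      ((4 + 4 / 3 * (R.Gfr 1 + R.Gfr 2 + R.Gfr 3)) * (2 : ℝ) ^ m) ^ j *
        (R.Gfr (k - j) * uPow (k - j) U * (((2 : ℝ) ^ m) ^ (2 * (k - j)) / ((2 : ℝ) ^ m) ^ 4)) :=
    sum_nonneg fun j _ => by
      have h1 : 0 ≤ uPow (k - j) U := by unfold uPow; split_ifs <;> positivity
      have h2 : 0 ≤ (4 + 4 / 3 * (R.Gfr 1 + R.Gfr 2 + R.Gfr 3)) * (2 : ℝ) ^ m := by
        nlinarith [hG0 1, hG0 2, hG0 3, pow_pos (by norm_num : (0:ℝ) < 2) m]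
      have h3 := hG0 (k - j)
      positivity
  unfold uvIncrQ uvIncrQ'
  constructor <;> positivity

/-- **The first space moment of the `m`-th INCREMENT of an admissible frame at cutoff `Λ`** (`m ≤ N_sc`, `0 < Λ ≤ 4`):
`(β/N)·Σ|b̃_l|·‖S[G_{b_{m+1}} − G_{bₘ}]‖ ≤ X_lin(Λ,B)·4608·S⁴·(U² + |U|/2ᵐ)`. -/
theorem spaceMoment_incrPiece_frame_le_at (hRwf : R.WF) (hU1 : |U| ≤ 1)
    (hS : ∀ n ≤ Nsc, ∀ j ≤ 4, ∀ q : Momentum, ‖iteratedFDeriv ℝ j (evalM (Kp n)) q‖ ≤ R.Gfr j * uPow j U * (4 : ℝ) ^ (((j : ℤ) - 2) * n))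
    (hβ2 : 2 ≤ β) (hβM : β ^ 3 ≤ (M : ℝ)) (hMN : 2 * M ≤ N) (hB1 : 1 ≤ B)
    (hB : ∀ i ≤ 5, ∀ t, ‖iteratedDeriv i salmhoferCutoff t‖ ≤ B) (hΛ : 0 < Λ) (hΛ4 : Λ ≤ 4) {m : ℕ} (hm : m ≤ Nsc)
    {l l' : Fin 2} (hll' : l ≠ l') :
    β / N * ∑ a : TorusSite 1 N, ∑ bv : TorusSite 2 L,
        |(((bv l).valMinAbs : ℤ) : ℝ)| *
          ‖∑ q₀ : TorusSite 1 N, ∑ qv : TorusSite 2 L, torusChar q₀ a * torusChar qv bv *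
            (uvGridSymbolBand L M N β Λ (fun y => frameLevel μ 0 (WithLp.toLp 2 (latticeMomentum L y)) -
                ∑ n ∈ range (m + 1), evalM (Kp n) (WithLp.toLp 2 (latticeMomentum L y))) -
              uvGridSymbolBand L M N β Λ (fun y => frameLevel μ 0 (WithLp.toLp 2 (latticeMomentum L y)) -
                ∑ n ∈ range m, evalM (Kp n) (WithLp.toLp 2 (latticeMomentum L y)))) q₀ qv‖ ≤
      (1 / 4 * Real.sqrt (216 * (1 / Λ + 1 / 2)) *
          ∑ e : Fin 2 × Fin 2, (uvLinV Λ (1 + (e.1 : ℕ) + (e.2 : ℕ)) *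
              (B * ((1 + ((e.1 : ℕ) + (e.2 : ℕ)) + 2).factorial : ℝ) * (4 / Λ) ^ (1 + ((e.1 : ℕ) + (e.2 : ℕ)) + 1)) +
            uvLinD Λ (1 + (e.1 : ℕ) + (e.2 : ℕ)) *
              (B * ((1 + ((e.1 : ℕ) + (e.2 : ℕ)) + 3).factorial : ℝ) * (4 / Λ) ^ (1 + ((e.1 : ℕ) + (e.2 : ℕ)) + 2)))) *
        (4608 * (1 + R.Gfr 0 + R.Gfr 1 + R.Gfr 2 + R.Gfr 3) ^ 4 * (U ^ 2 + |U| * (1 / 2 : ℝ) ^ m)) := by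
  -- rewrite the band of `G_{m+1}` as `bₘ + (−Kₘ)`
  have hband : (fun y : TorusSite 2 L => frameLevel μ 0 (WithLp.toLp 2 (latticeMomentum L y)) -
      ∑ n ∈ range (m + 1), evalM (Kp n) (WithLp.toLp 2 (latticeMomentum L y))) =
      fun y => (fun q : EuclideanSpace ℝ (Fin 2) => frameLevel μ 0 q - ∑ n ∈ range m, evalM (Kp n) q)
        (WithLp.toLp 2 (latticeMomentum L y)) +
        (fun q : EuclideanSpace ℝ (Fin 2) => -evalM (Kp m) q) (WithLp.toLp 2 (latticeMomentum L y)) := by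
    funext y; exact frameBandSeq_succ μ Kp m _
  rw [hband]
  have hstep := spaceMoment_incrPiece_le (L := L) (M := M) (N := N) hβ2 hΛ hΛ4 hβM hMN hB1 hB le_rfl
    (contDiff_frameBandSeq μ Kp m) (contDiff_evalM_neg (Kp m)) (frameBandSeq_periodic μ Kp m) (evalM_neg_periodic (Kp m))
    (D := (4 + 4 / 3 * (R.Gfr 1 + R.Gfr 2 + R.Gfr 3)) * (2 : ℝ) ^ m)
    (fun s hs i hi1 hi3 x => norm_iteratedFDeriv_frameBandInterp_le hRwf hU1 hS hm hs hi1 hi3 x)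
    (W := fun i => R.Gfr i * uPow i U * (((2 : ℝ) ^ m) ^ (2 * i) / ((2 : ℝ) ^ m) ^ 4))
    (fun i hi x => norm_iteratedFDeriv_framePiece_le hS hm (by omega) x) hll' (R := 4 ^ m) (Nat.one_le_pow _ _ (by norm_num))
  refine hstep.trans ?_
  have hQ := fun k => (uvIncrQ_frame_nonneg_at (U := U) hRwf hB1 hΛ m k).1
  have hQ' := fun k => (uvIncrQ_frame_nonneg_at (U := U) hRwf hB1 hΛ m k).2
  refine (uvSpaceMomentConst_le_linear hΛ (4 ^ m) hQ hQ').trans ?_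
  have h4m : ((4 ^ m : ℕ) : ℝ) = ((2 : ℝ) ^ m) ^ 2 := by
    push_cast; rw [← pow_mul, mul_comm, pow_mul]; norm_num
  rw [h4m, mul_assoc (1 / 4 * Real.sqrt (216 * (1 / Λ + 1 / 2))), mul_sum, mul_assoc (1 / 4 * Real.sqrt (216 * (1 / Λ + 1 / 2))),
    sum_mul]
  refine mul_le_mul_of_nonneg_left (sum_le_sum fun e _ => ?_) (by positivity)
  have hk' : (e.1 : ℕ) + (e.2 : ℕ) ≤ 2 := by have := e.1.isLt; have := e.2.isLt; omega
  have hV := scaledIncrQ_le hRwf hU1 hΛ hB1 m hk'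
  have hD := scaledIncrQ'_le hRwf hU1 hΛ hB1 m hk'
  have hV0 := uvLinV_nonneg hΛ (1 + (e.1 : ℕ) + (e.2 : ℕ))
  have hD0 := uvLinD_nonneg hΛ (1 + (e.1 : ℕ) + (e.2 : ℕ))
  rw [show 1 + (e.1 : ℕ) + (e.2 : ℕ) = 1 + ((e.1 : ℕ) + (e.2 : ℕ)) by ring] at hV0 hD0 ⊢
  calc ((2 : ℝ) ^ m) ^ 2 * ((1 / (4 * ((2 : ℝ) ^ m) ^ 2)) ^ ((e.1 : ℕ) + (e.2 : ℕ)) *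
        (uvLinV Λ (1 + ((e.1 : ℕ) + (e.2 : ℕ))) *
            uvIncrQ B Λ ((4 + 4 / 3 * (R.Gfr 1 + R.Gfr 2 + R.Gfr 3)) * (2 : ℝ) ^ m)
              (fun i => R.Gfr i * uPow i U * (((2 : ℝ) ^ m) ^ (2 * i) / ((2 : ℝ) ^ m) ^ 4)) (1 + ((e.1 : ℕ) + (e.2 : ℕ))) +
          uvLinD Λ (1 + ((e.1 : ℕ) + (e.2 : ℕ))) *
            uvIncrQ' B Λ ((4 + 4 / 3 * (R.Gfr 1 + R.Gfr 2 + R.Gfr 3)) * (2 : ℝ) ^ m)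
              (fun i => R.Gfr i * uPow i U * (((2 : ℝ) ^ m) ^ (2 * i) / ((2 : ℝ) ^ m) ^ 4)) (1 + ((e.1 : ℕ) + (e.2 : ℕ)))))
      = uvLinV Λ (1 + ((e.1 : ℕ) + (e.2 : ℕ))) *
          (((2 : ℝ) ^ m) ^ 2 * (1 / (4 * ((2 : ℝ) ^ m) ^ 2)) ^ ((e.1 : ℕ) + (e.2 : ℕ)) *
            uvIncrQ B Λ ((4 + 4 / 3 * (R.Gfr 1 + R.Gfr 2 + R.Gfr 3)) * (2 : ℝ) ^ m)
              (fun i => R.Gfr i * uPow i U * (((2 : ℝ) ^ m) ^ (2 * i) / ((2 : ℝ) ^ m) ^ 4)) (1 + ((e.1 : ℕ) + (e.2 : ℕ)))) +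
        uvLinD Λ (1 + ((e.1 : ℕ) + (e.2 : ℕ))) *
          (((2 : ℝ) ^ m) ^ 2 * (1 / (4 * ((2 : ℝ) ^ m) ^ 2)) ^ ((e.1 : ℕ) + (e.2 : ℕ)) *
            uvIncrQ' B Λ ((4 + 4 / 3 * (R.Gfr 1 + R.Gfr 2 + R.Gfr 3)) * (2 : ℝ) ^ m)
              (fun i => R.Gfr i * uPow i U * (((2 : ℝ) ^ m) ^ (2 * i) / ((2 : ℝ) ^ m) ^ 4)) (1 + ((e.1 : ℕ) + (e.2 : ℕ)))) := by ring
    _ ≤ uvLinV Λ (1 + ((e.1 : ℕ) + (e.2 : ℕ))) * (B * ((1 + ((e.1 : ℕ) + (e.2 : ℕ)) + 2).factorial : ℝ) *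
          (4 / Λ) ^ (1 + ((e.1 : ℕ) + (e.2 : ℕ)) + 1) *
          (4608 * (1 + R.Gfr 0 + R.Gfr 1 + R.Gfr 2 + R.Gfr 3) ^ 4 * (U ^ 2 + |U| * (1 / 2 : ℝ) ^ m))) +
        uvLinD Λ (1 + ((e.1 : ℕ) + (e.2 : ℕ))) * (B * ((1 + ((e.1 : ℕ) + (e.2 : ℕ)) + 3).factorial : ℝ) *
          (4 / Λ) ^ (1 + ((e.1 : ℕ) + (e.2 : ℕ)) + 2) *
          (4608 * (1 + R.Gfr 0 + R.Gfr 1 + R.Gfr 2 + R.Gfr 3) ^ 4 * (U ^ 2 + |U| * (1 / 2 : ℝ) ^ m))) :=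
        add_le_add (mul_le_mul_of_nonneg_left hV hV0) (mul_le_mul_of_nonneg_left hD hD0)
    _ = _ := by ring

/-- **The first space moment of the BARE piece at cutoff `Λ`** (band `e − μ`, scale `R = 1`, `0 < Λ ≤ 4`):
`(β/N)·Σ|b̃_l|·‖S[G_{e−μ}]‖ ≤ uvSpaceMomentConst Λ 1 (uvPieceSq Λ (uvBaseQ B Λ 4) (uvBaseQ′ B Λ 4))`. -/
theorem spaceMoment_basePiece_frame_le_at (hβ2 : 2 ≤ β) (hβM : β ^ 3 ≤ (M : ℝ)) (hMN : 2 * M ≤ N) (hB1 : 1 ≤ B)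
    (hB : ∀ i ≤ 5, ∀ t, ‖iteratedDeriv i salmhoferCutoff t‖ ≤ B) (hΛ : 0 < Λ) (hΛ4 : Λ ≤ 4) (μ : ℝ) {l l' : Fin 2} (hll' : l ≠ l') :
    β / N * ∑ a : TorusSite 1 N, ∑ bv : TorusSite 2 L,
        |(((bv l).valMinAbs : ℤ) : ℝ)| *
          ‖∑ q₀ : TorusSite 1 N, ∑ qv : TorusSite 2 L, torusChar q₀ a * torusChar qv bv *
            uvGridSymbolBand L M N β Λ (fun y => frameLevel μ 0 (WithLp.toLp 2 (latticeMomentum L y))) q₀ qv‖ ≤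
      uvSpaceMomentConst Λ 1 (uvPieceSq Λ (uvBaseQ B Λ 4) (uvBaseQ' B Λ 4)) := by
  have hper : ∀ (p : Fin 2 → ℝ) (z : Fin 2 → ℤ),
      frameLevel μ 0 (WithLp.toLp 2 (fun i => p i + z i * (2 * Real.pi))) = frameLevel μ 0 (WithLp.toLp 2 p) := by
    intro p z; rw [frameLevel_toLp_eq_ctBandFn, frameLevel_toLp_eq_ctBandFn, ctBandFn_periodic]
  exact spaceMoment_basePiece_le (L := L) (M := M) (N := N) hβ2 hΛ hΛ4 hβM hMN hB1 hB le_rfl (contDiff_frameLevel μ 0) hper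
    (D := 4) (fun i hi1 _ x => norm_iteratedFDeriv_frameLevel_zero_le_pow μ hi1 x) hll' le_rfl

/-- **The first SPACE moment of `C^K_{>Λ}` of an admissible frame**, uniform in `L`, `M`, `N` and the frame, in grid units: for
`FrameOK R U N_sc μ K`, `R.WF`, `|U| ≤ 1`, `klBetaMin ≤ β`, `β³ ≤ M`, `2M ≤ N`, cutoff derivatives `≤ B` up to order `5`, `0 < Λ ≤ 4` and `l ≠ l'`,
`(β/N)·Σ_{a,b⃗} |b̃_l|·‖S[G_σ](a,b⃗)‖ ≤ X₀(Λ,B) + X_lin(Λ,B)·4608·(1 + ΣGfr)⁴·((N_sc + 1)·U² + 2|U|)` (BGM 2006 (4.8b), `j = 1`, space direction `l`;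
telescoped over the frame pieces exactly as `EngineV8.spaceMoment_scaleZero_of_frameOK`, whose proof this is with `klE0 ↦ Λ`). -/
theorem spaceMoment_uvCov_of_frameOK [NeZero M] {K : TrigPolyC4v}
    (hK : FrameOK R U Nsc μ K) (hRwf : R.WF) (hU1 : |U| ≤ 1) (hβ : klBetaMin ≤ β) (hβM : β ^ 3 ≤ (M : ℝ)) (hMN : 2 * M ≤ N)
    (hB1 : 1 ≤ B) (hB : ∀ i ≤ 5, ∀ t, ‖iteratedDeriv i salmhoferCutoff t‖ ≤ B) (hΛ : 0 < Λ) (hΛ4 : Λ ≤ 4)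
    {l l' : Fin 2} (hll' : l ≠ l') (σ : Fin 2) :
    β / N * ∑ a : TorusSite 1 N, ∑ bv : TorusSite 2 L,
        |(((bv l).valMinAbs : ℤ) : ℝ)| *
          ‖∑ q₀ : TorusSite 1 N, ∑ qv : TorusSite 2 L, torusChar q₀ a * torusChar qv bv *
            gridSymbol L M N β (uvSymbolCT L M β μ K Λ) σ q₀ qv‖ ≤
      uvSpaceMomentConst Λ 1 (uvPieceSq Λ (uvBaseQ B Λ 4) (uvBaseQ' B Λ 4)) +
        (1 / 4 * Real.sqrt (216 * (1 / Λ + 1 / 2)) *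
            ∑ e : Fin 2 × Fin 2, (uvLinV Λ (1 + (e.1 : ℕ) + (e.2 : ℕ)) *
                (B * ((1 + ((e.1 : ℕ) + (e.2 : ℕ)) + 2).factorial : ℝ) * (4 / Λ) ^ (1 + ((e.1 : ℕ) + (e.2 : ℕ)) + 1)) +
              uvLinD Λ (1 + (e.1 : ℕ) + (e.2 : ℕ)) *
                (B * ((1 + ((e.1 : ℕ) + (e.2 : ℕ)) + 3).factorial : ℝ) * (4 / Λ) ^ (1 + ((e.1 : ℕ) + (e.2 : ℕ)) + 2)))) *
          (4608 * (1 + R.Gfr 0 + R.Gfr 1 + R.Gfr 2 + R.Gfr 3) ^ 4 * (((Nsc : ℝ) + 1) * U ^ 2 + 2 * |U|)) := by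
  obtain ⟨-, Kp, hsum, hS⟩ := hK
  have hβ2 : (2 : ℝ) ≤ β := le_trans (by norm_num [klBetaMin]) hβ
  have hβ0 : 0 < β := by linarith
  have hNpos : (0 : ℝ) < N := by exact_mod_cast Nat.pos_of_ne_zero (NeZero.ne N)
  -- the symbol is the last telescoping symbol
  set G : ℕ → TorusSite 1 N → TorusSite 2 L → ℂ := fun m =>
    uvGridSymbolBand L M N β Λ (fun y => frameLevel μ 0 (WithLp.toLp 2 (latticeMomentum L y)) -
      ∑ n ∈ range m, evalM (Kp n) (WithLp.toLp 2 (latticeMomentum L y))) with hGdef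
  have hsym : gridSymbol L M N β (uvSymbolCT L M β μ K Λ) σ = G (Nsc + 1) := by
    rw [gridSymbol_uvSymbolCT_eq_uvGridSymbolBand hβ0, nambuXiCT_eq_frameBandSeq_last (L := L) μ hsum]
  rw [hsym]
  -- telescoping of the weighted `ℓ¹` norm
  set w : TorusSite 1 N → TorusSite 2 L → ℝ := fun _ bv => |(((bv l).valMinAbs : ℤ) : ℝ)| with hw
  have hw0 : ∀ a bv, 0 ≤ w a bv := fun a bv => abs_nonneg _
  have htel := sum_sum_wt_norm_charSum_telescope_le w hw0 G (Nsc + 1)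
  simp only [hw] at htel
  refine (mul_le_mul_of_nonneg_left htel (by positivity)).trans ?_
  rw [mul_add]
  refine add_le_add ?_ ?_
  · -- the bare piece
    have hG0 : G 0 = uvGridSymbolBand L M N β Λ (fun y => frameLevel μ 0 (WithLp.toLp 2 (latticeMomentum L y))) := by
      simp only [hGdef, sum_range_zero, sub_zero]
    rw [hG0]
    exact spaceMoment_basePiece_frame_le_at (L := L) (M := M) (N := N) hβ2 hβM hMN hB1 hB hΛ hΛ4 μ hll'
  · -- the increments, summed over `m ≤ N_sc`
    have hincr : ∀ m ∈ range (Nsc + 1), β / N * ∑ a : TorusSite 1 N, ∑ bv : TorusSite 2 L,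
        |(((bv l).valMinAbs : ℤ) : ℝ)| * ‖∑ q₀ : TorusSite 1 N, ∑ qv : TorusSite 2 L, torusChar q₀ a * torusChar qv bv *
          (G (m + 1) - G m) q₀ qv‖ ≤
        (1 / 4 * Real.sqrt (216 * (1 / Λ + 1 / 2)) *
            ∑ e : Fin 2 × Fin 2, (uvLinV Λ (1 + (e.1 : ℕ) + (e.2 : ℕ)) *
                (B * ((1 + ((e.1 : ℕ) + (e.2 : ℕ)) + 2).factorial : ℝ) * (4 / Λ) ^ (1 + ((e.1 : ℕ) + (e.2 : ℕ)) + 1)) +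
              uvLinD Λ (1 + (e.1 : ℕ) + (e.2 : ℕ)) *
                (B * ((1 + ((e.1 : ℕ) + (e.2 : ℕ)) + 3).factorial : ℝ) * (4 / Λ) ^ (1 + ((e.1 : ℕ) + (e.2 : ℕ)) + 2)))) *
          (4608 * (1 + R.Gfr 0 + R.Gfr 1 + R.Gfr 2 + R.Gfr 3) ^ 4 * (U ^ 2 + |U| * (1 / 2 : ℝ) ^ m)) := by
      intro m hm
      have hm' : m ≤ Nsc := Nat.lt_succ_iff.1 (mem_range.1 hm)
      exact spaceMoment_incrPiece_frame_le_at (L := L) (M := M) (N := N) hRwf hU1 hS hβ2 hβM hMN hB1 hB hΛ hΛ4 hm' hll'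
    rw [mul_sum]
    refine (sum_le_sum hincr).trans ?_
    rw [← mul_sum, ← mul_sum]
    refine mul_le_mul_of_nonneg_left (mul_le_mul_of_nonneg_left ?_ (by positivity)) ?_
    · -- `Σ_{m ≤ N_sc} (U² + |U|/2ᵐ) ≤ (N_sc+1)U² + 2|U|`
      rw [sum_add_distrib, sum_const, card_range, nsmul_eq_mul, ← mul_sum]
      have hgeo : ∑ m ∈ range (Nsc + 1), (1 / 2 : ℝ) ^ m ≤ 2 := by
        rw [geom_sum_eq (by norm_num) (Nsc + 1)]
        have : 0 ≤ (1 / 2 : ℝ) ^ (Nsc + 1) := by positivity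
        have h : ((1 / 2 : ℝ) ^ (Nsc + 1) - 1) / (1 / 2 - 1) = 2 * (1 - (1 / 2 : ℝ) ^ (Nsc + 1)) := by field_simp; ring
        rw [h]; nlinarith
      push_cast
      nlinarith [abs_nonneg U, hgeo]
    · have hB0 : 0 ≤ B := zero_le_one.trans hB1
      refine mul_nonneg (by positivity) (sum_nonneg fun e _ => ?_)
      have h1 := uvLinV_nonneg hΛ (1 + (e.1 : ℕ) + (e.2 : ℕ))
      have h2 := uvLinD_nonneg hΛ (1 + (e.1 : ℕ) + (e.2 : ℕ))
      positivity

end Space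

end Summit.HubbardSuperconductivity.HubbardSuperconductivity.Theorems.UVCovarianceAt

end
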